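import Mathlib.Data.Matrix.Block
import Mathlib.Data.Matrix.ColumnRowPartitioned
import Mathlib.Data.Matrix.Basic
import Mathlib.Algebra.Ring.Idempotent
import Mathlib.GroupTheory.MonoidLocalization.GrothendieckGroup
import Mathlib.Logic.Equiv.Fin.Basic
import HarnessLib

/-!
# `K₀` of a ring via idempotent matrices

The Grothendieck group `K₀(R)` of a (unital, not necessarily commutative) ring `R`, in the
matrix-idempotent description of Husemöller–Joachim–Jurčo–Schottenloher, *Basic Bundle Theory and
`K`-Cohomology Invariants*, Ch. 3 §5 and Ch. 4 §§1, 4 (which is also Rosenberg's and Cortiñas'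
`K₀(R) = (Idem_∞ R / GL R)⁺`). Everything in this file is a definition with a body or a proved
theorem; no named facts.

* `AlgEquivalent p q` — *algebraic* (Murray–von Neumann) equivalence of square matrices of
  possibly different sizes: `∃ x y, x y = p ∧ y x = q` with the normalisation `x y x = x`,
  `y x y = y` (Ch. 3 Def. 5.4 with (5.2)(B)); on idempotents this is `∃ x y, x y = p ∧ y x = q`
  (`algEquivalent_iff`, Rem. 5.3) and it is an equivalence relation there (Prop. 5.5:
  `refl/symm/trans`). API: invariance under re-indexing (`submatrix`, `reindex`), block sums
  (`fromBlocks`, `fromBlocks_zero/comm/assoc`), conjugation (`conj`, Prop. 5.8 "⇒"), the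
  stabilised converse `exists_involution_conj` (`p ∼ q ⇒ w (p ⊕ 0) w = 0 ⊕ q`, `w² = 1`), and
  functoriality along ring homomorphisms (`map`, Ch. 4 Rem. 4.2).
* `Idem R` — idempotent matrices `p = p² ∈ Mₙ(R)` of all sizes (representatives), with block sum
  `+`, `Idem.unit n = 1ₙ` (the free module `Rⁿ`), `Idem.compl p = 1 - p`, `Idem.map f`.
* `IdemClass R` — **`Idem(R)`**, the abelian monoid of algebraic equivalence classes under
  `[p] + [q] = [p ⊕ q]` (Ch. 3 Def. 5.9, Ch. 4 Def. 4.1), and `IdemClass.map f` (Rem. 4.2).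
* `KZero R` — **`K₀(R) = T(Idem(R))`**, its group completion (Ch. 4 Constr. 1.4 / Prop. 1.7 =
  Mathlib's `Algebra.GrothendieckAddGroup`; Ch. 4 Def. 4.3), with `KZero.of p = [p]`,
  `exists_of_sub_of` (every element is `[p] - [q]`), the universal property (`lift_of`,
  `hom_ext`), covariant functoriality `KZero.map f` with `map_of/map_id/map_comp` (Rem. 4.4),
  `of_add_of_compl` (`[p] + [1 - p] = [1ₙ]`), and the description of equality in `K₀(R)` as
  *stable* algebraic equivalence: `of_eq_of_iff` (`∃ r, r ⊕ p ∼ r ⊕ q`) and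
  `of_eq_of_iff_exists_unit` (`∃ n, 1ₙ ⊕ p ∼ 1ₙ ⊕ q`).

This is the first brick of topological `K`-theory in the tree: for a compact Hausdorff space `X`,
`K⁰(X)` is `K₀(C(X, ℂ))` (Serre–Swan; op. cit. Ch. 4 Thm. 3.5), developed in
`Literature/AlgebraicTopology/KTheory/`.

## References

* D. Husemöller, M. Joachim, B. Jurčo, M. Schottenloher, *Basic Bundle Theory and `K`-Cohomology
  Invariants*, Lecture Notes in Physics 726, Springer (2008) [HusemollerEtAl2008] (held; PDF
  pp. 146–153 = book pp. 42–49): Ch. 3 §5 — Rem. 5.1 (`Rⁿ ≅ im p ⊕ ker p`), Notation 5.2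
  ((A) `xy = p, yx = q`; (B) `x = px = xq`, `y = qy = yp`), Rem. 5.3 (normalisation), Def. 5.4
  (algebraic equivalence), Prop. 5.5 (equivalence relation), Prop. 5.6 (`im p ≅ im q`), Prop. 5.8
  (conjugate iff `p ∼ p'` and `1 - p ∼ 1 - p'`), Def. 5.9 (`Idem(R)`, `Idem(w)`); Ch. 4 §1 —
  Constr. 1.4 (`T(A)`), Prop. 1.7 (universal property); §3 Thm. 3.5 (`K(X) ≅ K(C(X))`); §4 —
  Def. 4.1 (`[p'] + [p''] = [p' ⊕ p'']`), Rem. 4.2 (`Idem(f)`), Def. 4.3 (`I(R) = T(Idem(R))`),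
  Rem. 4.4 (functoriality), Thm. 4.5 (`I(R) ≅ K(R)`).
* G. Cortiñas, *Algebraic v. topological `K`-theory: a friendly match*, in Baum et al., *Topics in
  Algebraic and Topological `K`-Theory*, LNM 2008 (2011), §2.1, Def. 2.1.3 and Rem. 2.1.9 (held;
  the `GL`-conjugacy description and its agreement with projective modules).

## Design notes

* Sizes are natural numbers and representatives are `Fin n`-indexed, so that `Idem R : Type u`
  and `KZero R : Type u` live in the universe of `R`; matrices indexed by an arbitrary `Fintype`
  enter through `Idem.ofMatrix` / `AlgEquivalent.reindex`. The relation `AlgEquivalent` itself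
  is stated for arbitrary finite index types, which is the form in which block manipulations
  (`Matrix.fromBlocks`, `Sum`-indexed) are painless.
* The normalisation (5.2)(B) is built into `AlgEquivalent` (as `xyx = x`, `yxy = y`), which
  makes `trans` hypothesis-free; `AlgEquivalent.of_mul_eq` recovers the relation from (A) alone
  on idempotents (Rem. 5.3), so nothing is lost.
* `KZero R` is an `abbrev` for `Algebra.GrothendieckAddGroup (IdemClass R)`, so Mathlib's
  `AddCommGroup` instance and `lift` apply verbatim.
* Not here: the isomorphism with the Grothendieck group of finitely generated projective
  modules (Thm. 4.5) and with Mathlib's `Module.Projective`; the ring structure for commutative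
  `R` (tensor/Kronecker product of idempotents); `K₁`; `K₀` of non-unital rings. The scheme-level
  `Literature.AlgebraicGeometry.KTheory.KZero` (vector bundles on a scheme, exact sequences) is a
  different object and is not related to this one here.
* Mathlib searches (`lean search --decl`, 2026-08-15): `KTheory`, `K0`/`KZero` (only the
  scheme-level Literature file), `Murray`, `IsIdempotentElem.*Matrix`, `GrothendieckAddGroup`
  (Mathlib, used): Mathlib has no `K₀` of a ring and no equivalence of idempotents/projections.
  Nothing restated.
-/

namespace Literature.RingTheory.KTheory

open Matrix

universe u v

variable {R : Type u} [Ring R]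
variable {ι κ μ : Type*} [Fintype ι] [Fintype κ] [Fintype μ]

/-- Two square matrices `p ∈ M_ι(R)` and `q ∈ M_κ(R)` over a ring `R`, of possibly different
sizes, are **algebraically equivalent** (Murray–von Neumann equivalent) if there are rectangular
matrices `x : ι × κ` and `y : κ × ι` with `x y = p`, `y x = q` (condition (5.2)(A) of the source)
and `x y x = x`, `y x y = y` (equivalent to the source's normalisation (5.2)(B):
`x = p x = x q`, `y = q y = y p`). Such `p`, `q` are automatically idempotent
(`AlgEquivalent.isIdempotentElem_left/right`), and for idempotent `p`, `q` the normalisation can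
always be arranged (Rem. 5.3 of the source, `AlgEquivalent.of_mul_eq`), so on idempotents this
is exactly "`∃ x y, x y = p ∧ y x = q`" (`algEquivalent_iff`), i.e. `im p ≅ im q` as `R`-modules
(Prop. 5.6 there). [cite: HusemollerEtAl2008, Ch. 3 Def. 5.4] -/
def AlgEquivalent (p : Matrix ι ι R) (q : Matrix κ κ R) : Prop :=
  ∃ (x : Matrix ι κ R) (y : Matrix κ ι R), x * y = p ∧ y * x = q ∧ x * y * x = x ∧ y * x * y = y

namespace AlgEquivalent

/-- The left member of an algebraically equivalent pair is idempotent. [folklore] -/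
theorem isIdempotentElem_left {p : Matrix ι ι R} {q : Matrix κ κ R} (h : AlgEquivalent p q) :
    IsIdempotentElem p := by
  obtain ⟨x, y, rfl, -, hx, -⟩ := h
  change x * y * (x * y) = x * y
  rw [← Matrix.mul_assoc, hx]

/-- The right member of an algebraically equivalent pair is idempotent. [folklore] -/
theorem isIdempotentElem_right {p : Matrix ι ι R} {q : Matrix κ κ R} (h : AlgEquivalent p q) :
    IsIdempotentElem q := by
  obtain ⟨x, y, -, rfl, -, hy⟩ := h
  change y * x * (y * x) = y * x
  rw [← Matrix.mul_assoc, hy]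

/-- **Normalisation** (Husemöller et al., Ch. 3 Rem. 5.3): if `p = x'y'` and `q = y'x'` with `p`,
`q` idempotent, then `x = p x' q`, `y = q y' p` witness the algebraic equivalence of `p` and `q`
(here `x = x'y'x'(y'x')`, `y = y'x'y'(x'y')`). [cite: HusemollerEtAl2008, Ch. 3 Rem. 5.3] -/
theorem of_mul_eq {p : Matrix ι ι R} {q : Matrix κ κ R} (hp : IsIdempotentElem p)
    (hq : IsIdempotentElem q) {x : Matrix ι κ R} {y : Matrix κ ι R} (hxy : x * y = p)
    (hyx : y * x = q) : AlgEquivalent p q := by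
  subst hxy hyx
  have hp2 : x * y * (x * y) = x * y := hp.eq
  have hq2 : y * x * (y * x) = y * x := hq.eq
  refine ⟨x * y * x * (y * x), y * x * y * (x * y), ?_, ?_, ?_, ?_⟩
  · calc x * y * x * (y * x) * (y * x * y * (x * y))
        = x * y * (x * y) * (x * y) * (x * y) * (x * y) := by simp only [Matrix.mul_assoc]
      _ = x * y := by rw [hp2, hp2, hp2, hp2]
  · calc y * x * y * (x * y) * (x * y * x * (y * x))
        = y * x * (y * x) * (y * x) * (y * x) * (y * x) := by simp only [Matrix.mul_assoc]
      _ = y * x := by rw [hq2, hq2, hq2, hq2]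
  · calc x * y * x * (y * x) * (y * x * y * (x * y)) * (x * y * x * (y * x))
        = x * y * (x * y) * (x * y) * (x * y) * (x * y) * (x * y) * (x * y) * x := by
          simp only [Matrix.mul_assoc]
      _ = x * y * (x * y) * x := by simp only [hp2]
      _ = x * y * x * (y * x) := by simp only [Matrix.mul_assoc]
  · calc y * x * y * (x * y) * (x * y * x * (y * x)) * (y * x * y * (x * y))
        = y * x * (y * x) * (y * x) * (y * x) * (y * x) * (y * x) * (y * x) * y := by
          simp only [Matrix.mul_assoc]
      _ = y * x * (y * x) * y := by simp only [hq2]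
      _ = y * x * y * (x * y) := by simp only [Matrix.mul_assoc]

/-- On idempotents, algebraic equivalence is the relation `∃ x y, x y = p ∧ y x = q`
(Husemöller et al., Ch. 3 Def. 5.4 with Rem. 5.3). [cite: HusemollerEtAl2008, Ch. 3 Def. 5.4] -/
theorem _root_.Literature.RingTheory.KTheory.algEquivalent_iff {p : Matrix ι ι R}
    {q : Matrix κ κ R} (hp : IsIdempotentElem p) (hq : IsIdempotentElem q) :
    AlgEquivalent p q ↔ ∃ (x : Matrix ι κ R) (y : Matrix κ ι R), x * y = p ∧ y * x = q :=
  ⟨fun ⟨x, y, hxy, hyx, _, _⟩ ↦ ⟨x, y, hxy, hyx⟩, fun ⟨_, _, hxy, hyx⟩ ↦ of_mul_eq hp hq hxy hyx⟩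

/-- The normal form `x = p x = x q`, `y = q y = y p` of a witnessing pair ((5.2)(B) of the source).
[cite: HusemollerEtAl2008, Ch. 3 Rem. 5.3] -/
theorem exists_normalized {p : Matrix ι ι R} {q : Matrix κ κ R} (h : AlgEquivalent p q) :
    ∃ (x : Matrix ι κ R) (y : Matrix κ ι R),
      x * y = p ∧ y * x = q ∧ p * x = x ∧ x * q = x ∧ q * y = y ∧ y * p = y := by
  obtain ⟨x, y, rfl, rfl, hx, hy⟩ := h
  refine ⟨x, y, rfl, rfl, hx, ?_, hy, ?_⟩
  · rw [← Matrix.mul_assoc]; exact hx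
  · rw [← Matrix.mul_assoc]; exact hy

/-- An idempotent is algebraically equivalent to itself (`x = y = p`).
[cite: HusemollerEtAl2008, Ch. 3 Prop. 5.5] -/
theorem refl {p : Matrix ι ι R} (hp : IsIdempotentElem p) : AlgEquivalent p p :=
  ⟨p, p, hp.eq, hp.eq, by rw [hp.eq, hp.eq], by rw [hp.eq, hp.eq]⟩

/-- Algebraic equivalence is symmetric. [cite: HusemollerEtAl2008, Ch. 3 Prop. 5.5] -/
theorem symm {p : Matrix ι ι R} {q : Matrix κ κ R} (h : AlgEquivalent p q) : AlgEquivalent q p := by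
  obtain ⟨x, y, h₁, h₂, h₃, h₄⟩ := h
  exact ⟨y, x, h₂, h₁, h₄, h₃⟩

/-- Algebraic equivalence is transitive: with normalised `p = xy, q = yx` and `q = uv, r = vu`
one has `(xu)(vy) = xqy = p` and `(vy)(xu) = vqu = r`. [cite: HusemollerEtAl2008, Ch. 3 Prop. 5.5] -/
theorem trans {p : Matrix ι ι R} {q : Matrix κ κ R} {r : Matrix μ μ R}
    (h₁ : AlgEquivalent p q) (h₂ : AlgEquivalent q r) : AlgEquivalent p r := by
  obtain ⟨x, y, hxy, hyx, -, hxq, -, -⟩ := h₁.exists_normalized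
  obtain ⟨u, v, huv, hvu, hqu, -, -, hvq⟩ := h₂.exists_normalized
  refine of_mul_eq h₁.isIdempotentElem_left h₂.isIdempotentElem_right (x := x * u) (y := v * y)
    ?_ ?_
  · calc x * u * (v * y) = x * (u * v) * y := by simp only [Matrix.mul_assoc]
      _ = p := by rw [huv, hxq, hxy]
  · calc v * y * (x * u) = v * (y * x * u) := by simp only [Matrix.mul_assoc]
      _ = r := by rw [hyx, hqu, hvu]


/-- The zero matrices of any two sizes are algebraically equivalent. [folklore] -/
theorem zero_zero : AlgEquivalent (0 : Matrix ι ι R) (0 : Matrix κ κ R) :=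
  ⟨0, 0, Matrix.zero_mul _, Matrix.zero_mul _, by simp, by simp⟩

/-- A matrix algebraically equivalent to a zero matrix vanishes. [folklore] -/
theorem eq_zero_of_zero_right {p : Matrix ι ι R} (h : AlgEquivalent p (0 : Matrix κ κ R)) :
    p = 0 := by
  obtain ⟨x, y, hxy, hyx, hx, -⟩ := h
  rw [← hxy, ← hx, Matrix.mul_assoc x y x, hyx, Matrix.mul_zero, Matrix.zero_mul]

/-- A block sum of idempotents is idempotent. [folklore] -/
theorem _root_.Literature.RingTheory.KTheory.isIdempotentElem_fromBlocks {p : Matrix ι ι R}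
    {q : Matrix κ κ R} (hp : IsIdempotentElem p) (hq : IsIdempotentElem q) :
    IsIdempotentElem (Matrix.fromBlocks p 0 0 q) := by
  rw [IsIdempotentElem, Matrix.fromBlocks_multiply]
  simp [hp.eq, hq.eq]

/-- A re-indexed idempotent is idempotent. [folklore] -/
theorem _root_.Literature.RingTheory.KTheory.isIdempotentElem_submatrix {p : Matrix ι ι R}
    (hp : IsIdempotentElem p) (e : κ ≃ ι) : IsIdempotentElem (p.submatrix e e) := by
  rw [IsIdempotentElem, Matrix.submatrix_mul_equiv, hp.eq]

/-- An idempotent matrix is algebraically equivalent to any re-indexing of itself along an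
equivalence of index types (`x = p.submatrix id e`, `y = p.submatrix e id`). [folklore] -/
theorem submatrix {p : Matrix ι ι R} (hp : IsIdempotentElem p) (e : κ ≃ ι) :
    AlgEquivalent p (p.submatrix e e) := by
  refine of_mul_eq hp (isIdempotentElem_submatrix hp e) (x := p.submatrix id e)
    (y := p.submatrix e id) ?_ ?_
  · rw [Matrix.submatrix_mul_equiv, hp.eq, Matrix.submatrix_id_id]
  · rw [← Matrix.submatrix_mul _ _ _ _ _ Function.bijective_id, hp.eq]

/-- `Matrix.reindex` preserves the algebraic equivalence class of an idempotent. [folklore] -/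
theorem reindex {p : Matrix ι ι R} (hp : IsIdempotentElem p) (e : ι ≃ κ) :
    AlgEquivalent p (Matrix.reindex e e p) :=
  submatrix hp e.symm

/-- Block sums of algebraically equivalent matrices are algebraically equivalent
(`x = x₁ ⊕ x₂`, `y = y₁ ⊕ y₂`): the sum `[p] + [q] = [p ⊕ q]` is well defined on classes.
[cite: HusemollerEtAl2008, Ch. 4 Def. 4.1] -/
theorem fromBlocks {ν : Type*} [Fintype ν] {p : Matrix ι ι R} {q : Matrix κ κ R}
    {p' : Matrix μ μ R} {q' : Matrix ν ν R} (h₁ : AlgEquivalent p p') (h₂ : AlgEquivalent q q') :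
    AlgEquivalent (Matrix.fromBlocks p 0 0 q) (Matrix.fromBlocks p' 0 0 q') := by
  have hp := isIdempotentElem_fromBlocks h₁.isIdempotentElem_left h₂.isIdempotentElem_left
  have hp' := isIdempotentElem_fromBlocks h₁.isIdempotentElem_right h₂.isIdempotentElem_right
  obtain ⟨x, y, rfl, rfl, -, -⟩ := h₁
  obtain ⟨u, v, rfl, rfl, -, -⟩ := h₂
  refine of_mul_eq hp hp' (x := Matrix.fromBlocks x 0 0 u) (y := Matrix.fromBlocks y 0 0 v) ?_ ?_ <;>
    simp [Matrix.fromBlocks_multiply]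

/-- Adding a zero block does not change the class of an idempotent: `p ⊕ 0 ∼ p` via
`x = (p; 0)`, `y = (p 0)` (the zero idempotent is the zero of `Idem(R)`).
[cite: HusemollerEtAl2008, Ch. 4 Def. 4.1] -/
theorem fromBlocks_zero {p : Matrix ι ι R} (hp : IsIdempotentElem p) :
    AlgEquivalent (Matrix.fromBlocks p 0 0 (0 : Matrix κ κ R)) p := by
  refine of_mul_eq (isIdempotentElem_fromBlocks hp IsIdempotentElem.zero) hp
    (x := Matrix.fromRows p 0) (y := Matrix.fromCols p 0) ?_ ?_
  · rw [Matrix.fromRows_mul_fromCols, hp.eq]; simp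
  · rw [Matrix.fromCols_mul_fromRows, hp.eq]; simp

/-- Block sum is commutative up to algebraic equivalence (conjugation by the block swap).
[cite: HusemollerEtAl2008, Ch. 4 Def. 4.1] -/
theorem fromBlocks_comm {p : Matrix ι ι R} {q : Matrix κ κ R} (hp : IsIdempotentElem p)
    (hq : IsIdempotentElem q) :
    AlgEquivalent (Matrix.fromBlocks p 0 0 q) (Matrix.fromBlocks q 0 0 p) := by
  simpa using AlgEquivalent.submatrix (isIdempotentElem_fromBlocks hp hq) (Equiv.sumComm κ ι)

/-- Block sum is associative up to algebraic equivalence (re-bracketing of the index type).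
[cite: HusemollerEtAl2008, Ch. 4 Def. 4.1] -/
theorem fromBlocks_assoc {p : Matrix ι ι R} {q : Matrix κ κ R} {r : Matrix μ μ R}
    (hp : IsIdempotentElem p) (hq : IsIdempotentElem q) (hr : IsIdempotentElem r) :
    AlgEquivalent (Matrix.fromBlocks (Matrix.fromBlocks p 0 0 q) 0 0 r)
      (Matrix.fromBlocks p 0 0 (Matrix.fromBlocks q 0 0 r)) := by
  have h := AlgEquivalent.submatrix
    (isIdempotentElem_fromBlocks (isIdempotentElem_fromBlocks hp hq) hr) (Equiv.sumAssoc ι κ μ).symm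
  convert h using 2
  ext (i | j | k) (i' | j' | k') <;> rfl

section conj

variable [DecidableEq ι] [DecidableEq κ]

/-- Conjugate idempotents are algebraically equivalent: if `v u = 1` then `p ∼ u p v`
(`x = p v`, `y = u p`). [cite: HusemollerEtAl2008, Ch. 3 Prop. 5.8] -/
theorem conj {p u v : Matrix ι ι R} (hp : IsIdempotentElem p) (hvu : v * u = 1) :
    AlgEquivalent p (u * p * v) := by
  have hpvup : p * v * (u * p) = p := by
    calc p * v * (u * p) = p * (v * u) * p := by simp only [Matrix.mul_assoc]
      _ = p := by rw [hvu, Matrix.mul_one, hp.eq]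
  have hupv : IsIdempotentElem (u * p * v) := by
    change u * p * v * (u * p * v) = u * p * v
    calc u * p * v * (u * p * v) = u * (p * v * (u * p)) * v := by simp only [Matrix.mul_assoc]
      _ = u * p * v := by rw [hpvup]
  refine of_mul_eq hp hupv (x := p * v) (y := u * p) hpvup ?_
  calc u * p * (p * v) = u * (p * p) * v := by simp only [Matrix.mul_assoc]
    _ = u * p * v := by rw [hp.eq]

/-- **Algebraically equivalent idempotents become conjugate after adding zero blocks**, by an
involution: if `p ∼ q` there is `w ∈ M_{ι ⊕ κ}(R)` with `w w = 1` and `w (p ⊕ 0) w = 0 ⊕ q`,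
namely `w = ((1 - p, x), (y, 1 - q))` for a normalised pair `x, y` (the stabilised converse of
Husemöller et al., Ch. 3 Prop. 5.8; the usual "rotation" trick). [folklore] -/
theorem exists_involution_conj {p : Matrix ι ι R} {q : Matrix κ κ R} (h : AlgEquivalent p q) :
    ∃ w : Matrix (ι ⊕ κ) (ι ⊕ κ) R, w * w = 1 ∧
      w * Matrix.fromBlocks p 0 0 0 * w = Matrix.fromBlocks 0 0 0 q := by
  have hp := h.isIdempotentElem_left
  have hq := h.isIdempotentElem_right
  obtain ⟨x, y, hxy, hyx, hpx, hxq, hqy, hyp⟩ := h.exists_normalized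
  refine ⟨Matrix.fromBlocks (1 - p) x y (1 - q), ?_, ?_⟩
  · rw [Matrix.fromBlocks_multiply, ← Matrix.fromBlocks_one]
    congr 1
    · simp [Matrix.sub_mul, Matrix.mul_sub, hp.eq, hxy]
    · simp [Matrix.sub_mul, Matrix.mul_sub, hpx, hxq]
    · simp [Matrix.sub_mul, Matrix.mul_sub, hqy, hyp]
    · simp [Matrix.sub_mul, Matrix.mul_sub, hq.eq, hyx]
  · rw [Matrix.fromBlocks_multiply, Matrix.fromBlocks_multiply]
    congr 1
    · simp [Matrix.sub_mul, hp.eq]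
    · simp [Matrix.sub_mul, Matrix.mul_sub, hp.eq]
    · simp [Matrix.mul_sub, hyp]
    · simp [hyp, hyx]

end conj

/-- Entrywise images under a ring homomorphism of algebraically equivalent matrices are
algebraically equivalent: `Idem(f)` is well defined. [cite: HusemollerEtAl2008, Ch. 4 Rem. 4.2] -/
theorem map {S : Type v} [Ring S] (f : R →+* S) {p : Matrix ι ι R} {q : Matrix κ κ R}
    (h : AlgEquivalent p q) : AlgEquivalent (p.map f) (q.map f) := by
  obtain ⟨x, y, rfl, rfl, hx, hy⟩ := h
  refine ⟨x.map f, y.map f, Matrix.map_mul.symm, Matrix.map_mul.symm, ?_, ?_⟩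
  · rw [← Matrix.map_mul, ← Matrix.map_mul, hx]
  · rw [← Matrix.map_mul, ← Matrix.map_mul, hy]

end AlgEquivalent

/-! ### `Idem(R)`: classes of idempotent matrices, an abelian monoid under block sum -/

variable (R) in
/-- An idempotent square matrix `p = p² ∈ Mₙ(R)` of some size `n` over the ring `R` — a
representative of an element of `Idem(R)` (Husemöller et al., Ch. 3 Def. 5.9). Its image `p Rⁿ`
is a finitely generated projective (right) `R`-module, and every such module is of this form
(Ch. 3 Rem. 5.1 there). [cite: HusemollerEtAl2008, Ch. 3 Def. 5.9] -/
structure Idem where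
  /-- the size `n` of the matrix -/
  size : ℕ
  /-- the idempotent `n × n` matrix -/
  mat : Matrix (Fin size) (Fin size) R
  /-- idempotency `p * p = p` -/
  isIdempotentElem : IsIdempotentElem mat

namespace Idem

/-- The zero idempotent (of size `0`), representing the zero module. -/
instance : Zero (Idem R) := ⟨⟨0, 0, IsIdempotentElem.zero⟩⟩

/-- The identity `1ₙ ∈ Mₙ(R)`, representing the free module `Rⁿ`; `[1₁]` is the unit of the
semiring `Idem(R)`. [cite: HusemollerEtAl2008, Ch. 4 Def. 4.1] -/
def unit (n : ℕ) : Idem R := ⟨n, 1, IsIdempotentElem.one⟩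

/-- Block sum `p ⊕ q = diag(p, q) ∈ M_{m+n}(R)` of idempotent matrices (re-indexed along
`Fin m ⊕ Fin n ≃ Fin (m + n)`); it induces the addition of `Idem(R)`.
[cite: HusemollerEtAl2008, Ch. 4 Def. 4.1] -/
def blockSum (p q : Idem R) : Idem R where
  size := p.size + q.size
  mat := Matrix.reindex finSumFinEquiv finSumFinEquiv (Matrix.fromBlocks p.mat 0 0 q.mat)
  isIdempotentElem :=
    isIdempotentElem_submatrix (isIdempotentElem_fromBlocks p.isIdempotentElem q.isIdempotentElem) _

/-- `p + q` on `Idem R` is the block sum. -/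
instance : Add (Idem R) := ⟨blockSum⟩

/-- The block sum, unfolded. [folklore] -/
theorem add_mat (p q : Idem R) : (p + q).mat =
    Matrix.reindex finSumFinEquiv finSumFinEquiv (Matrix.fromBlocks p.mat 0 0 q.mat) := rfl

/-- Sizes add under block sum. [folklore] -/
@[simp] theorem add_size (p q : Idem R) : (p + q).size = p.size + q.size := rfl

/-- Algebraic equivalence of the underlying matrices, as a setoid on `Idem R`
(an equivalence relation by Husemöller et al., Ch. 3 Prop. 5.5).
[cite: HusemollerEtAl2008, Ch. 3 Prop. 5.5] -/
instance setoid : Setoid (Idem R) where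
  r p q := AlgEquivalent p.mat q.mat
  iseqv := ⟨fun p ↦ AlgEquivalent.refl p.isIdempotentElem, AlgEquivalent.symm, AlgEquivalent.trans⟩

/-- `p ≈ q` in `Idem R` means algebraic equivalence of the matrices. [folklore] -/
theorem equiv_iff {p q : Idem R} : p ≈ q ↔ AlgEquivalent p.mat q.mat := Iff.rfl

/-- The block sum is algebraically equivalent to the plain block matrix `diag(p, q)`. [folklore] -/
theorem add_equiv_fromBlocks (p q : Idem R) :
    AlgEquivalent (p + q).mat (Matrix.fromBlocks p.mat 0 0 q.mat) :=
  (AlgEquivalent.reindex (isIdempotentElem_fromBlocks p.isIdempotentElem q.isIdempotentElem) _).symm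

/-- Block sum respects algebraic equivalence. [cite: HusemollerEtAl2008, Ch. 4 Def. 4.1] -/
theorem add_congr {p p' q q' : Idem R} (hp : p ≈ p') (hq : q ≈ q') : p + q ≈ p' + q' :=
  (add_equiv_fromBlocks p q).trans
    ((AlgEquivalent.fromBlocks hp hq).trans (add_equiv_fromBlocks p' q').symm)

/-- Block sum is commutative up to algebraic equivalence. [cite: HusemollerEtAl2008, Ch. 4 Def. 4.1] -/
theorem add_comm_equiv (p q : Idem R) : p + q ≈ q + p :=
  (add_equiv_fromBlocks p q).trans
    ((AlgEquivalent.fromBlocks_comm p.isIdempotentElem q.isIdempotentElem).trans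
      (add_equiv_fromBlocks q p).symm)

/-- Block sum is associative up to algebraic equivalence.
[cite: HusemollerEtAl2008, Ch. 4 Def. 4.1] -/
theorem add_assoc_equiv (p q r : Idem R) : p + q + r ≈ p + (q + r) :=
  (add_equiv_fromBlocks (p + q) r).trans <|
    ((add_equiv_fromBlocks p q).fromBlocks (AlgEquivalent.refl r.isIdempotentElem)).trans <|
      (AlgEquivalent.fromBlocks_assoc p.isIdempotentElem q.isIdempotentElem r.isIdempotentElem).trans
        <| ((AlgEquivalent.refl p.isIdempotentElem).fromBlocks (add_equiv_fromBlocks q r).symm).trans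
          (add_equiv_fromBlocks p (q + r)).symm

/-- The zero idempotent is a right unit for block sum up to algebraic equivalence.
[cite: HusemollerEtAl2008, Ch. 4 Def. 4.1] -/
theorem add_zero_equiv (p : Idem R) : p + 0 ≈ p :=
  (add_equiv_fromBlocks p 0).trans (AlgEquivalent.fromBlocks_zero p.isIdempotentElem)

/-- The zero idempotent is a left unit for block sum up to algebraic equivalence.
[cite: HusemollerEtAl2008, Ch. 4 Def. 4.1] -/
theorem zero_add_equiv (p : Idem R) : 0 + p ≈ p :=
  (add_comm_equiv 0 p).trans (add_zero_equiv p)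

section ofMatrix

/-- The representative in `Idem R` of an idempotent matrix indexed by an arbitrary finite type,
enumerated along `Fintype.equivFin`. [folklore] -/
noncomputable def ofMatrix (p : Matrix ι ι R) (hp : IsIdempotentElem p) : Idem R :=
  ⟨Fintype.card ι, Matrix.reindex (Fintype.equivFin ι) (Fintype.equivFin ι) p,
    isIdempotentElem_submatrix hp _⟩

/-- `ofMatrix p` is algebraically equivalent to `p`. [folklore] -/
theorem algEquivalent_ofMatrix (p : Matrix ι ι R) (hp : IsIdempotentElem p) :
    AlgEquivalent (ofMatrix p hp).mat p :=
  (AlgEquivalent.reindex hp _).symm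

end ofMatrix

/-- Entrywise image of an idempotent matrix under a ring homomorphism (`Idem(f)` on
representatives). [cite: HusemollerEtAl2008, Ch. 4 Rem. 4.2] -/
def map {S : Type v} [Ring S] (f : R →+* S) (p : Idem R) : Idem S :=
  ⟨p.size, p.mat.map f, by rw [IsIdempotentElem, ← Matrix.map_mul, p.isIdempotentElem.eq]⟩

/-- Two representatives of the same size with equal matrices are equal. [folklore] -/
theorem mk_eq_mk_of_eq {n : ℕ} {M N : Matrix (Fin n) (Fin n) R} (hM : IsIdempotentElem M)
    (hN : IsIdempotentElem N) (h : M = N) : (⟨n, M, hM⟩ : Idem R) = ⟨n, N, hN⟩ := by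
  subst h; rfl

/-- `Idem.map` sends the zero idempotent to the zero idempotent.
[cite: HusemollerEtAl2008, Ch. 4 Rem. 4.2] -/
theorem map_zero {S : Type v} [Ring S] (f : R →+* S) : (0 : Idem R).map f = 0 :=
  mk_eq_mk_of_eq _ _ (Matrix.map_zero f (_root_.map_zero f))

/-- `Idem.map` commutes with block sum (on the nose). [cite: HusemollerEtAl2008, Ch. 4 Rem. 4.2] -/
theorem map_add {S : Type v} [Ring S] (f : R →+* S) (p q : Idem R) :
    (p + q).map f = p.map f + q.map f :=
  mk_eq_mk_of_eq _ _ <| by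
    change ((Matrix.reindex _ _) _).map f = Matrix.reindex _ _ _
    simp only [Matrix.reindex_apply, ← Matrix.submatrix_map, Matrix.fromBlocks_map,
      Matrix.map_zero f (_root_.map_zero f)]
    rfl

end Idem

variable (R) in
/-- **`Idem(R)`**: the set of algebraic equivalence classes `[p]` of idempotent matrices
`p = p² ∈ Mₙ(R)`, `n ≥ 0` (Husemöller et al., Ch. 3 Def. 5.9), an abelian monoid under
`[p] + [q] = [p ⊕ q]` (Ch. 4 Def. 4.1). It is isomorphic to the monoid `Vect/R` of isomorphism
classes of finitely generated projective `R`-modules under `⊕` (Ch. 4 Thm. 4.5; not proved here).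
[cite: HusemollerEtAl2008, Ch. 3 Def. 5.9] -/
def IdemClass : Type u := Quotient (Idem.setoid (R := R))

namespace IdemClass

/-- The class `[p] ∈ Idem(R)` of an idempotent matrix. [cite: HusemollerEtAl2008, Ch. 3 Def. 5.9] -/
def mk (p : Idem R) : IdemClass R := Quotient.mk _ p

/-- Every class has a representative. [folklore] -/
theorem mk_surjective : Function.Surjective (mk : Idem R → IdemClass R) :=
  Quotient.mk_surjective

/-- Two idempotent matrices have the same class iff they are algebraically equivalent.
[cite: HusemollerEtAl2008, Ch. 3 Def. 5.9] -/
theorem mk_eq_mk {p q : Idem R} : mk p = mk q ↔ AlgEquivalent p.mat q.mat := Quotient.eq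

/-- Addition on `Idem(R)`: `[p] + [q] = [p ⊕ q]`, well defined by `Idem.add_congr`. -/
instance : Add (IdemClass R) :=
  ⟨Quotient.map₂ (· + ·) fun _ _ hp _ _ hq ↦ Idem.add_congr hp hq⟩

/-- The zero of `Idem(R)` is the class of the zero idempotent. -/
instance : Zero (IdemClass R) := ⟨mk 0⟩

/-- `Idem(R)` is an abelian monoid under block sum (Husemöller et al., Ch. 4 Def. 4.1).
[cite: HusemollerEtAl2008, Ch. 4 Def. 4.1] -/
instance : AddCommMonoid (IdemClass R) where
  add_assoc := by
    rintro ⟨p⟩ ⟨q⟩ ⟨r⟩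
    exact Quotient.sound (Idem.add_assoc_equiv p q r)
  zero_add := by
    rintro ⟨p⟩
    exact Quotient.sound (Idem.zero_add_equiv p)
  add_zero := by
    rintro ⟨p⟩
    exact Quotient.sound (Idem.add_zero_equiv p)
  add_comm := by
    rintro ⟨p⟩ ⟨q⟩
    exact Quotient.sound (Idem.add_comm_equiv p q)
  nsmul := nsmulRec

/-- `[p] + [q] = [p ⊕ q]`. [cite: HusemollerEtAl2008, Ch. 4 Def. 4.1] -/
theorem mk_add_mk (p q : Idem R) : mk p + mk q = mk (p + q) := rfl

/-- `[0] = 0`. [cite: HusemollerEtAl2008, Ch. 4 Def. 4.1] -/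
theorem mk_zero : mk (0 : Idem R) = 0 := rfl

/-- `Idem(f) : Idem(R) → Idem(S)` for a ring homomorphism `f`, a monoid homomorphism.
[cite: HusemollerEtAl2008, Ch. 4 Rem. 4.2] -/
def map {S : Type v} [Ring S] (f : R →+* S) : IdemClass R →+ IdemClass S where
  toFun := Quotient.map (Idem.map f) fun _ _ h ↦ AlgEquivalent.map f h
  map_zero' := by
    change mk _ = mk _
    rw [Idem.map_zero]
  map_add' := by
    rintro ⟨p⟩ ⟨q⟩
    change mk _ = mk _
    rw [Idem.map_add]

/-- `Idem(f) [p] = [f(p)]`. [cite: HusemollerEtAl2008, Ch. 4 Rem. 4.2] -/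
theorem map_mk {S : Type v} [Ring S] (f : R →+* S) (p : Idem R) : map f (mk p) = mk (p.map f) :=
  rfl

end IdemClass

/-! ### `K₀(R)` -/

variable (R) in
/-- **`K₀(R)`, the Grothendieck group of the ring `R` via idempotents**: the group completion
(Husemöller et al., Ch. 4 Constr. 1.4, Prop. 1.7 — Mathlib's `Algebra.GrothendieckAddGroup`) of
the abelian monoid `Idem(R)` of algebraic equivalence classes of idempotent matrices under block
sum; this is the functor `I(R) = T(Idem(R))` of Ch. 4 Def. 4.3 there, isomorphic to the
Grothendieck group `K(R)` of finitely generated projective modules (Ch. 4 Thm. 4.5, via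
`p ↦ im p`; equally Rosenberg's / Cortiñas' `K₀(R) = (Idem_∞(R)/GL(R))⁺`). The comparison with
projective modules is not formalised here; this group is taken as the definition of `K₀`.
[cite: HusemollerEtAl2008, Ch. 4 Def. 4.3] -/
abbrev KZero : Type u := Algebra.GrothendieckAddGroup (IdemClass R)

namespace KZero

/-- The class `[p] ∈ K₀(R)` of an idempotent matrix. [cite: HusemollerEtAl2008, Ch. 4 Def. 4.3] -/
def of (p : Idem R) : KZero R := Algebra.GrothendieckAddGroup.of (IdemClass.mk p)

/-- `[p] = p / 0` in the localisation model of the Grothendieck group. [folklore] -/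
theorem of_eq_mk (p : Idem R) : of p = AddLocalization.mk (IdemClass.mk p) 0 := rfl

/-- `[p ⊕ q] = [p] + [q]` in `K₀(R)`. [cite: HusemollerEtAl2008, Ch. 4 Def. 4.3] -/
theorem of_add (p q : Idem R) : of (p + q) = of p + of q := by
  simp [of, ← IdemClass.mk_add_mk]

/-- `[0] = 0` in `K₀(R)`. [cite: HusemollerEtAl2008, Ch. 4 Def. 4.3] -/
theorem of_zero : of (0 : Idem R) = 0 := by
  simp [of, IdemClass.mk_zero]

/-- Algebraically equivalent idempotents have the same class in `K₀(R)`.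
[cite: HusemollerEtAl2008, Ch. 4 Def. 4.3] -/
theorem of_eq_of {p q : Idem R} (h : AlgEquivalent p.mat q.mat) : of p = of q := by
  rw [of, of, IdemClass.mk_eq_mk.2 h]

/-- Every element of `K₀(R)` is a formal difference `[p] - [q]` of classes of idempotents.
[cite: HusemollerEtAl2008, Ch. 4 Constr. 1.4] -/
theorem exists_of_sub_of (x : KZero R) : ∃ p q : Idem R, x = of p - of q := by
  induction x using AddLocalization.induction_on with
  | H y =>
    obtain ⟨a, ⟨b, hb⟩⟩ := y
    obtain ⟨p, rfl⟩ := IdemClass.mk_surjective a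
    obtain ⟨q, rfl⟩ := IdemClass.mk_surjective b
    refine ⟨p, q, ?_⟩
    rw [sub_eq_add_neg, of_eq_mk, of_eq_mk, Algebra.GrothendieckAddGroup.neg_mk,
      AddLocalization.mk_add]
    congr 1
    · exact (add_zero _).symm
    · exact Subtype.ext (zero_add _).symm

/-- The universal extension of an additive map `f : Idem(R) → G` to `K₀(R)` agrees with `f` on
classes of idempotents (Husemöller et al., Ch. 4 Prop. 1.7: `h θ = f`).
[cite: HusemollerEtAl2008, Ch. 4 Prop. 1.7] -/
theorem lift_of {G : Type*} [AddCommGroup G] (f : IdemClass R →+ G) (p : Idem R) :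
    Algebra.GrothendieckAddGroup.lift f (of p) = f (IdemClass.mk p) :=
  (AddLocalization.addMonoidOf ⊤).lift_eq (g := f) (fun _ ↦ AddGroup.isAddUnit _) _

/-- Additive maps out of `K₀(R)` are determined by their values on classes of idempotents
(uniqueness in the universal property, Husemöller et al., Ch. 4 Prop. 1.7).
[cite: HusemollerEtAl2008, Ch. 4 Prop. 1.7] -/
theorem hom_ext {G : Type*} [AddCommGroup G] {g₁ g₂ : KZero R →+ G}
    (h : ∀ p : Idem R, g₁ (of p) = g₂ (of p)) : g₁ = g₂ := by
  apply (Algebra.GrothendieckAddGroup.lift (M := IdemClass R) (G := G)).symm.injective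
  ext x
  obtain ⟨p, rfl⟩ := IdemClass.mk_surjective x
  rw [Algebra.GrothendieckAddGroup.lift_symm_apply, Algebra.GrothendieckAddGroup.lift_symm_apply]
  exact h p

/-- **`K₀(f) : K₀(R) → K₀(S)`** for a ring homomorphism `f : R → S`: the group homomorphism
induced (Ch. 4 Prop. 1.7) by the monoid homomorphism `Idem(f)`, `[p] ↦ [f(p)]`
(Husemöller et al., Ch. 4 Rem. 4.4). [cite: HusemollerEtAl2008, Ch. 4 Rem. 4.4] -/
noncomputable def map {S : Type v} [Ring S] (f : R →+* S) : KZero R →+ KZero S :=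
  Algebra.GrothendieckAddGroup.lift
    ((Algebra.GrothendieckAddGroup.of (M := IdemClass S)).comp (IdemClass.map f))

/-- `K₀(f) [p] = [f(p)]`. [cite: HusemollerEtAl2008, Ch. 4 Rem. 4.4] -/
@[simp] theorem map_of {S : Type v} [Ring S] (f : R →+* S) (p : Idem R) :
    map f (of p) = of (p.map f) := by
  rw [map, lift_of]; rfl

/-- `K₀(id) = id`. [cite: HusemollerEtAl2008, Ch. 4 Rem. 4.4] -/
theorem map_id : map (RingHom.id R) = AddMonoidHom.id (KZero R) :=
  hom_ext fun p ↦ by rw [map_of]; rfl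

/-- `K₀(g ∘ f) = K₀(g) ∘ K₀(f)` (covariant functoriality). [cite: HusemollerEtAl2008, Ch. 4 Rem. 4.4] -/
theorem map_comp {S : Type v} {T : Type*} [Ring S] [Ring T] (f : R →+* S) (g : S →+* T) :
    map (g.comp f) = (map g).comp (map f) :=
  hom_ext fun p ↦ by simp only [map_of, AddMonoidHom.coe_comp, Function.comp_apply]; rfl

/-! ### Equality in `K₀(R)` is stable algebraic equivalence -/

/-- `[p] = [q]` in `K₀(R)` iff `r ⊕ p ∼ r ⊕ q` for some idempotent `r` (the defining relation of
the group completion, Husemöller et al., Ch. 4 Constr. 1.4). [cite: HusemollerEtAl2008, Ch. 4 Constr. 1.4] -/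
theorem of_eq_of_iff {p q : Idem R} : of p = of q ↔ ∃ r : Idem R, r + p ≈ r + q := by
  rw [of_eq_mk, of_eq_mk, AddLocalization.mk_eq_mk_iff, AddLocalization.r_iff_exists]
  constructor
  · rintro ⟨⟨c, hc'⟩, hc⟩
    obtain ⟨r, rfl⟩ := IdemClass.mk_surjective c
    refine ⟨r, Idem.equiv_iff.2 (IdemClass.mk_eq_mk.1 ?_)⟩
    simpa [IdemClass.mk_add_mk] using hc
  · rintro ⟨r, hr⟩
    refine ⟨⟨IdemClass.mk r, AddSubmonoid.mem_top _⟩, ?_⟩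
    have := IdemClass.mk_eq_mk.2 (Idem.equiv_iff.1 hr)
    simpa [IdemClass.mk_add_mk] using this

end KZero

namespace Idem

/-- The complementary idempotent `1 - p` (same size). [folklore] -/
def compl (p : Idem R) : Idem R := ⟨p.size, 1 - p.mat, p.isIdempotentElem.one_sub⟩

/-- `p ⊕ (1 - p) ∼ 1ₙ`: an idempotent and its complement add up to a free module
(`x = (p; 1 - p)`, `y = (p, 1 - p)`). [cite: HusemollerEtAl2008, Ch. 3 Rem. 5.1] -/
theorem add_compl_equiv (p : Idem R) : p + p.compl ≈ unit p.size := by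
  refine (add_equiv_fromBlocks p p.compl).trans ?_
  change AlgEquivalent
    (Matrix.fromBlocks p.mat 0 0 (1 - p.mat) : Matrix (Fin p.size ⊕ Fin p.size) (Fin p.size ⊕ Fin p.size) R)
    (1 : Matrix (Fin p.size) (Fin p.size) R)
  have hp := p.isIdempotentElem
  have h1 : p.mat * (1 - p.mat) = 0 := by rw [Matrix.mul_sub, Matrix.mul_one, hp.eq, sub_self]
  have h2 : (1 - p.mat) * p.mat = 0 := by rw [Matrix.sub_mul, Matrix.one_mul, hp.eq, sub_self]
  refine AlgEquivalent.of_mul_eq (isIdempotentElem_fromBlocks hp hp.one_sub) IsIdempotentElem.one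
    (x := Matrix.fromRows p.mat (1 - p.mat)) (y := Matrix.fromCols p.mat (1 - p.mat)) ?_ ?_
  · rw [Matrix.fromRows_mul_fromCols, hp.eq, hp.one_sub.eq, h1, h2]
  · rw [Matrix.fromCols_mul_fromRows, hp.eq, hp.one_sub.eq, add_sub_cancel]

end Idem

namespace KZero

/-- `[p] + [1 - p] = [1ₙ]` in `K₀(R)`. [cite: HusemollerEtAl2008, Ch. 3 Rem. 5.1] -/
theorem of_add_of_compl (p : Idem R) : of p + of p.compl = of (Idem.unit p.size) := by
  rw [← of_add, of_eq_of (Idem.add_compl_equiv p)]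

/-- **Equality in `K₀(R)` is stable equivalence**: `[p] = [q]` iff `1ₙ ⊕ p ∼ 1ₙ ⊕ q` for some
`n`, i.e. iff `p` and `q` become algebraically equivalent (equivalently, conjugate, by
`AlgEquivalent.exists_involution_conj`) after adding a free summand. [folklore] -/
theorem of_eq_of_iff_exists_unit {p q : Idem R} :
    of p = of q ↔ ∃ n : ℕ, Idem.unit n + p ≈ Idem.unit n + q := by
  refine ⟨fun h ↦ ?_, fun ⟨n, hn⟩ ↦ of_eq_of_iff.2 ⟨_, hn⟩⟩
  obtain ⟨r, hr⟩ := of_eq_of_iff.1 h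
  refine ⟨r.size, ?_⟩
  have key : ∀ s : Idem R, Idem.unit r.size + s ≈ r.compl + (r + s) := fun s ↦
    (Idem.add_congr (Setoid.symm (Idem.add_compl_equiv r)) (Setoid.refl s)).trans <|
      (Idem.add_congr (Idem.add_comm_equiv r r.compl) (Setoid.refl s)).trans
        (Idem.add_assoc_equiv r.compl r s)
  exact (key p).trans ((Idem.add_congr (Setoid.refl _) hr).trans (Setoid.symm (key q)))

end KZero

end Literature.RingTheory.KTheory
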